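import Summits.Ventures.PercRepro2.CaseOneSeries

/-!
# Suppressing a series vertex: the four Props transfer in both directions
(blind cell PercRepro2, p1 g22; the Props layer of `CaseOneSeries`)

With `iiExpr_series`, `iExpr_series`, `iiExprT_series`, `iExprT_series`, `Dqo_series` and
`probQ_series` (CaseOneSeries), `(ii)`, `(i)`, `(ii-Q)`, `(i-Q)` at a vertex `v` hold in `G` iff they
hold in the graph with the series vertex `w ∉ {o, a₁, a₂, v, b}` contracted away
(`zSplitII_series_iff`, …), whence the `_of_series` directions used by the class theorems. Own code;
standard axioms. -/

namespace Summit.Ventures.PercRepro2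

namespace CaseOne

/-! ## The Props transfer (both directions) -/

section Props
variable {V : Type*} {E : Type*} [Fintype E] [DecidableEq E] {R : Type*} [CommRing R] [LinearOrder R]
variable {ends : E → Sym2 V} {o a₁ a₂ v b x w z : V} {e₀ e₁ : E}

/-- `(ii)` in `G` iff `(ii)` in the contracted graph (`w ∉ {o, a₁, a₂, v, b}`). -/
theorem zSplitII_series_iff (p : E → R) (h : IsSeriesAt ends x w z e₀ e₁) (ho : o ≠ w) (h1 : a₁ ≠ w)
    (h2 : a₂ ≠ w) (hv : v ≠ w) (hb : b ≠ w) :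
    ZSplitII p ends o a₁ a₂ v b ↔
      ZSplitII (seriesW p e₀ e₁) (seriesEnds ends e₀ e₁ x z) o a₁ a₂ v b := by
  unfold ZSplitII
  rw [iiExpr_series p h ho h1 h2 hv hb]

/-- `(i)` in `G` iff `(i)` in the contracted graph (`w ∉ {o, a₁, a₂, v, b}`). -/
theorem zSplitI_series_iff (p : E → R) (h : IsSeriesAt ends x w z e₀ e₁) (ho : o ≠ w) (h1 : a₁ ≠ w)
    (h2 : a₂ ≠ w) (hv : v ≠ w) (hb : b ≠ w) :
    ZSplitI p ends o a₁ a₂ v b ↔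
      ZSplitI (seriesW p e₀ e₁) (seriesEnds ends e₀ e₁ x z) o a₁ a₂ v b := by
  unfold ZSplitI
  rw [iExpr_series p h ho h1 h2 hv hb]

/-- `(ii-Q)` in `G` iff `(ii-Q)` in the contracted graph (`w ∉ {o, a₁, a₂, v, b}`). -/
theorem zSplitIIQ_series_iff (p : E → R) (h : IsSeriesAt ends x w z e₀ e₁) (ho : o ≠ w) (h1 : a₁ ≠ w)
    (h2 : a₂ ≠ w) (hv : v ≠ w) (hb : b ≠ w) :
    ZSplitIIQ p ends o a₁ a₂ v b ↔
      ZSplitIIQ (seriesW p e₀ e₁) (seriesEnds ends e₀ e₁ x z) o a₁ a₂ v b := by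
  unfold ZSplitIIQ
  rw [iiExprT_series p h ho h1 h2 hv hb, Dqo_series p h ho h1 h2, probQ_series p h h1 h2]

/-- `(i-Q)` in `G` iff `(i-Q)` in the contracted graph (`w ∉ {o, a₁, a₂, v, b}`). -/
theorem zSplitIQ_series_iff (p : E → R) (h : IsSeriesAt ends x w z e₀ e₁) (ho : o ≠ w) (h1 : a₁ ≠ w)
    (h2 : a₂ ≠ w) (hv : v ≠ w) (hb : b ≠ w) :
    ZSplitIQ p ends o a₁ a₂ v b ↔
      ZSplitIQ (seriesW p e₀ e₁) (seriesEnds ends e₀ e₁ x z) o a₁ a₂ v b := by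
  unfold ZSplitIQ
  rw [iExprT_series p h ho h1 h2 hv hb, Dqo_series p h ho h1 h2, probQ_series p h h1 h2]

/-- `(ii)` in the contracted graph gives `(ii)` in `G`. -/
theorem zSplitII_of_series (p : E → R) (h : IsSeriesAt ends x w z e₀ e₁) (ho : o ≠ w) (h1 : a₁ ≠ w)
    (h2 : a₂ ≠ w) (hv : v ≠ w) (hb : b ≠ w)
    (hz : ZSplitII (seriesW p e₀ e₁) (seriesEnds ends e₀ e₁ x z) o a₁ a₂ v b) :
    ZSplitII p ends o a₁ a₂ v b :=
  (zSplitII_series_iff p h ho h1 h2 hv hb).2 hz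

/-- `(i)` in the contracted graph gives `(i)` in `G`. -/
theorem zSplitI_of_series (p : E → R) (h : IsSeriesAt ends x w z e₀ e₁) (ho : o ≠ w) (h1 : a₁ ≠ w)
    (h2 : a₂ ≠ w) (hv : v ≠ w) (hb : b ≠ w)
    (hz : ZSplitI (seriesW p e₀ e₁) (seriesEnds ends e₀ e₁ x z) o a₁ a₂ v b) :
    ZSplitI p ends o a₁ a₂ v b :=
  (zSplitI_series_iff p h ho h1 h2 hv hb).2 hz

/-- `(ii-Q)` in the contracted graph gives `(ii-Q)` in `G`. -/
theorem zSplitIIQ_of_series (p : E → R) (h : IsSeriesAt ends x w z e₀ e₁) (ho : o ≠ w) (h1 : a₁ ≠ w)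
    (h2 : a₂ ≠ w) (hv : v ≠ w) (hb : b ≠ w)
    (hz : ZSplitIIQ (seriesW p e₀ e₁) (seriesEnds ends e₀ e₁ x z) o a₁ a₂ v b) :
    ZSplitIIQ p ends o a₁ a₂ v b :=
  (zSplitIIQ_series_iff p h ho h1 h2 hv hb).2 hz

/-- `(i-Q)` in the contracted graph gives `(i-Q)` in `G`. -/
theorem zSplitIQ_of_series (p : E → R) (h : IsSeriesAt ends x w z e₀ e₁) (ho : o ≠ w) (h1 : a₁ ≠ w)
    (h2 : a₂ ≠ w) (hv : v ≠ w) (hb : b ≠ w)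
    (hz : ZSplitIQ (seriesW p e₀ e₁) (seriesEnds ends e₀ e₁ x z) o a₁ a₂ v b) :
    ZSplitIQ p ends o a₁ a₂ v b :=
  (zSplitIQ_series_iff p h ho h1 h2 hv hb).2 hz

end Props

end CaseOne

end Summit.Ventures.PercRepro2
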